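import Mathlib
import Literature.Analysis.SpecialFunctions.SphericalBesselFunctions
import HarnessLib

/-!
# Pointwise leakage of the Legendre section (handoff prove-1, ATTEMPT-17 §5; the special-function core of step (TB-3) of LEMMA TB)

Step (TB-3) of LEMMA TB (HOME handoff/IDEAS-prolate.md §87.4; handoff/prove-1/ATTEMPT-16.md §4) bounds
the near-null sampling form from below by a finite `K × K` matrix on the span `V_K` of the first `K`
Legendre polynomials of the window; the complement `V_K^⊥` is controlled by the POINTWISE LEAKAGE
`|Fw(t)|² ≤ L_K(t) ‖w‖²` for `w ⊥ V_K`, `L_K(t) = 2a (1 - Σ_{k<K} (2k+1) j_k(at)²)` (spherical Bessel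
`j_k`; Rayleigh's expansion A&S 10.1.47 and the square-sum identity A&S 10.1.50).  This file proves
the leakage inequality on the reference window `[-1, 1]` (`a = 1`; the general window is a dilation),
in the tree's `L²([-1,1]) = Lp ℂ 2 legendreMeasure` with its Legendre Hilbert basis `legendreL2` and
spherical Bessel functions `sphBesselJ` (`Literature.Analysis.SpecialFunctions`):

* `norm_sq_inner_le_of_orthogonal` — abstract Hilbert-space lemma: for an orthonormal family `b`, a
  finite index set `S` and `w` orthogonal to `{b k : k ∈ S}`,
  `‖⟪e, w⟫‖² ≤ (‖e‖² - Σ_{k ∈ S} ‖⟪b k, e⟫‖²) · ‖w‖²` (Bessel's inequality applied to `e`, then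
  Cauchy–Schwarz against `e` minus its projection);
* `norm_sq_inner_cexp_le_leakage` — for `w ∈ L²([-1,1])` with `⟪P̃_k, w⟫ = 0` for `k < K` and every
  real `x`: `‖⟪e^{ix·}, w⟫‖² ≤ (2 - 2 Σ_{k<K} (2k+1) j_k(x)²) · ‖w‖²`, i.e. `L_K(x)` at `a = 1`
  (`⟪e^{ix·}, w⟫ = ∫_{-1}^{1} w(t) e^{-ixt} dt = Fw(-x)`, and `L_K` is even in `x`).

Nothing in this file bears on the truth of RH; no hypothesis on the zeros of `ζ` is used.
-/

set_option linter.dupNamespace false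

open scoped Real ComplexConjugate InnerProductSpace
open Complex MeasureTheory Set Filter Literature.Analysis.SpecialFunctions

namespace Summit.RiemannHypothesis.RiemannHypothesis.Theorems

section Abstract

variable {E : Type*} [NormedAddCommGroup E] [InnerProductSpace ℂ E] {ι : Type*}

/-- **Leakage past a finite orthonormal section.** If `b` is an orthonormal family, `S` a finite set
of indices and `w ⊥ b k` for every `k ∈ S`, then for every `e`:
`‖⟪e, w⟫‖² ≤ (‖e‖² - Σ_{k ∈ S} ‖⟪b k, e⟫‖²) · ‖w‖²`. -/
theorem norm_sq_inner_le_of_orthogonal {b : ι → E} (hb : Orthonormal ℂ b) (S : Finset ι) {w : E}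
    (hw : ∀ k ∈ S, ⟪b k, w⟫_ℂ = 0) (e : E) :
    ‖⟪e, w⟫_ℂ‖ ^ 2 ≤ (‖e‖ ^ 2 - ∑ k ∈ S, ‖⟪b k, e⟫_ℂ‖ ^ 2) * ‖w‖ ^ 2 := by
  classical
  -- the section `s = Σ_{k∈S} ⟪b k, e⟫ b k` of `e`
  set c : ι → ℂ := fun k ↦ ⟪b k, e⟫_ℂ with hc
  set s : E := ∑ k ∈ S, c k • b k with hs
  -- `w ⊥ s`
  have hsw : ⟪s, w⟫_ℂ = 0 := by
    rw [hs, sum_inner]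
    exact Finset.sum_eq_zero fun k hk ↦ by rw [inner_smul_left, hw k hk, mul_zero]
  -- `⟪e, s⟫ = Σ |c k|²` and `‖s‖² = Σ |c k|²`
  have hes : ⟪e, s⟫_ℂ = ((∑ k ∈ S, ‖c k‖ ^ 2 : ℝ) : ℂ) := by
    rw [hs, inner_sum]
    push_cast
    refine Finset.sum_congr rfl fun k _ ↦ ?_
    rw [inner_smul_right, ← inner_conj_symm]
    exact Complex.mul_conj' (c k)
  have hss' : ⟪s, s⟫_ℂ = ((∑ k ∈ S, ‖c k‖ ^ 2 : ℝ) : ℂ) := by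
    rw [hs, hb.inner_sum c c S]
    push_cast
    refine Finset.sum_congr rfl fun k _ ↦ ?_
    rw [mul_comm]
    exact Complex.mul_conj' (c k)
  have hss : ‖s‖ ^ 2 = ∑ k ∈ S, ‖c k‖ ^ 2 := by
    have h := inner_self_eq_norm_sq (𝕜 := ℂ) s
    rw [hss', RCLike.re_to_complex, Complex.ofReal_re] at h
    exact h.symm
  -- `‖e - s‖² = ‖e‖² - Σ |c k|²`
  have hdiff : ‖e - s‖ ^ 2 = ‖e‖ ^ 2 - ∑ k ∈ S, ‖c k‖ ^ 2 := by
    rw [@norm_sub_sq ℂ, hes, hss]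
    simp only [Complex.ofReal_re, RCLike.re_to_complex]
    ring
  -- `⟪e, w⟫ = ⟪e - s, w⟫`, Cauchy–Schwarz
  have hew : ⟪e, w⟫_ℂ = ⟪e - s, w⟫_ℂ := by rw [inner_sub_left, hsw, sub_zero]
  rw [hew, ← hdiff]
  have hCS := norm_inner_le_norm (𝕜 := ℂ) (e - s) w
  have h0 : 0 ≤ ‖⟪e - s, w⟫_ℂ‖ := norm_nonneg _
  calc ‖⟪e - s, w⟫_ℂ‖ ^ 2 ≤ (‖e - s‖ * ‖w‖) ^ 2 := pow_le_pow_left₀ h0 hCS 2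
    _ = ‖e - s‖ ^ 2 * ‖w‖ ^ 2 := by ring

end Abstract

/-! ### The Legendre section of `L²([-1,1])` against `e^{ix·}` -/

/-- `‖⟪P̃_k, e^{ix·}⟫‖² = 2 (2k+1) j_k(x)²` (Rayleigh's coefficients, A&S 10.1.47). -/
theorem norm_sq_inner_legendreL2_cexp (k : ℕ) (x : ℝ) :
    ‖⟪legendreL2 k, (memLp_cexp_I_mul x).toLp _⟫_ℂ‖ ^ 2 = 2 * (2 * k + 1) * sphBesselJ k x ^ 2 := by
  rw [inner_legendreL2_cexp, norm_mul, Complex.norm_real, Real.norm_eq_abs, norm_gegenbauerIntegral_eq,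
    mul_pow, mul_pow, sq_abs, sq_abs, legendreNormConst_sq]
  ring

/-- **Pointwise leakage of the Legendre section (step (TB-3) of LEMMA TB, reference window).**
If `w ∈ L²([-1,1])` is orthogonal to the first `K` normalised Legendre polynomials, then for every
real `x`: `‖⟪e^{ix·}, w⟫‖² ≤ (2 - 2 Σ_{k<K} (2k+1) j_k(x)²) · ‖w‖²` — the leakage function
`L_K(x) = 2(1 - Σ_{k<K}(2k+1) j_k(x)²)` of IDEAS-prolate §87.4 at `a = 1` (A&S 10.1.47 / 10.1.50). -/
theorem norm_sq_inner_cexp_le_leakage (K : ℕ) {w : Lp ℂ 2 legendreMeasure}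
    (hw : ∀ k < K, ⟪legendreL2 k, w⟫_ℂ = 0) (x : ℝ) :
    ‖⟪(memLp_cexp_I_mul x).toLp _, w⟫_ℂ‖ ^ 2 ≤
      (2 - 2 * ∑ k ∈ Finset.range K, (2 * k + 1) * sphBesselJ k x ^ 2) * ‖w‖ ^ 2 := by
  have h := norm_sq_inner_le_of_orthogonal orthonormal_legendreL2 (Finset.range K)
    (fun k hk ↦ hw k (Finset.mem_range.1 hk)) ((memLp_cexp_I_mul x).toLp _)
  rw [norm_sq_toLp_cexp_I_mul, Finset.sum_congr rfl fun k _ ↦ norm_sq_inner_legendreL2_cexp k x] at h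
  have e : 2 * ∑ k ∈ Finset.range K, (2 * (k : ℝ) + 1) * sphBesselJ k x ^ 2 =
      ∑ k ∈ Finset.range K, 2 * (2 * (k : ℝ) + 1) * sphBesselJ k x ^ 2 := by
    rw [Finset.mul_sum]
    exact Finset.sum_congr rfl fun k _ ↦ by ring
  rw [e]
  exact h

/-- The leakage function is at most `2` and the bound is never worse than Cauchy–Schwarz:
`0 ≤ Σ_{k<K} (2k+1) j_k(x)² ≤ 1` (A&S 10.1.50). -/
theorem sum_sq_sphBesselJ_le_one (K : ℕ) (x : ℝ) :
    ∑ k ∈ Finset.range K, (2 * k + 1) * sphBesselJ k x ^ 2 ≤ 1 :=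
  sum_le_hasSum (Finset.range K) (fun i _ ↦ by positivity) (hasSum_sq_sphBesselJ x)

/-! ### The section/complement step of (TB-3) as real arithmetic (appended 2026-08-24, prove-1 gen10)

IDEAS-prolate §87.4: writing a window function as `g = u + w` (`u ∈ V_K`, `w ⊥ V_K`, `X = ‖u‖`,
`Y = ‖w‖`), the two-band form `T = 𝒱_{αΦ} + K_c⁻¹⟨(I - P)·,·⟩` satisfies
`T(g) ≥ (1-ε)t_K X² - 2K_c⁻¹ε_K XY + (K_c⁻¹(1-ε_K²) - (ε⁻¹-1)B_K) Y²` once the section bottom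
`t_K`, the leakages `B_K` (Gram, from `norm_sq_inner_cexp_le_leakage` at the Gram zeros) and `ε_K²`
(band), and Cauchy–Schwarz for the band form are available; a positive-semidefinite `2 × 2` test
then gives `T(g) ≥ t* ‖g‖²`.  The two lemmas below are exactly these two steps, with every
analytic quantity entering as a real hypothesis (the certificate supplies them as balls). -/

/-- **Binary quadratic forms:** if `λ ≤ a`, `λ ≤ d` and `b² ≤ (a - λ)(d - λ)` then
`λ (X² + Y²) ≤ a X² - 2 b X Y + d Y²` (the matrix `[[a, -b], [-b, d]] - λ I` is positive
semidefinite). -/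
theorem quadForm_two_lower {a b d lam X Y : ℝ} (ha : lam ≤ a) (hd : lam ≤ d)
    (hdet : b ^ 2 ≤ (a - lam) * (d - lam)) :
    lam * (X ^ 2 + Y ^ 2) ≤ a * X ^ 2 - 2 * b * X * Y + d * Y ^ 2 := by
  have ha' : 0 ≤ a - lam := sub_nonneg.2 ha
  have hd' : 0 ≤ d - lam := sub_nonneg.2 hd
  suffices h : 0 ≤ (a - lam) * X ^ 2 - 2 * b * X * Y + (d - lam) * Y ^ 2 by nlinarith
  rcases ha'.eq_or_lt with h0 | hpos
  · have hb : b = 0 := by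
      have : b ^ 2 ≤ 0 := by rw [← h0, zero_mul] at hdet; exact hdet
      exact pow_eq_zero_iff (n := 2) (by norm_num) |>.1 (le_antisymm this (sq_nonneg b))
    rw [← h0, hb]
    nlinarith [sq_nonneg Y]
  · have key : 0 ≤ (a - lam) * ((a - lam) * X ^ 2 - 2 * b * X * Y + (d - lam) * Y ^ 2) := by
      have e : (a - lam) * ((a - lam) * X ^ 2 - 2 * b * X * Y + (d - lam) * Y ^ 2) =
          ((a - lam) * X - b * Y) ^ 2 + ((a - lam) * (d - lam) - b ^ 2) * Y ^ 2 := by ring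
      rw [e]
      nlinarith [sq_nonneg ((a - lam) * X - b * Y), sq_nonneg Y]
    exact (mul_nonneg_iff_of_pos_left hpos).1 key

/-- **The section/complement inequality of (TB-3), real form.** Inputs: the split value
`T ≥ (1-ε)V_u - (ε⁻¹-1)V_w + K_c⁻¹(X² + Y² - P_uu - 2R - P_ww)` (from `|a+b|² ≥ (1-ε)|a|² - (ε⁻¹-1)|b|²`
termwise in the Gram form and `⟨(I-P)(u+w), u+w⟩` expanded, `R = Re⟪Pu, w⟫`), the section bottom
`t_K X² ≤ V_u + K_c⁻¹(X² - P_uu)`, `P ≤ I` on `u`, the Gram leakage `V_w ≤ B_K Y²`, the band leakage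
`P_ww ≤ ε_K² Y²` and Cauchy–Schwarz `|R| ≤ ε_K X Y`.  Output:
`(1-ε) t_K X² - 2 K_c⁻¹ ε_K X Y + (K_c⁻¹(1 - ε_K²) - (ε⁻¹ - 1) B_K) Y² ≤ T`. -/
theorem twoBand_section_lower {T Vu Vw X Y Puu Pww R tK εK BK Kc ε : ℝ} (hKc : 0 < Kc)
    (hε0 : 0 < ε) (hε1 : ε ≤ 1)
    (hT : (1 - ε) * Vu - (ε⁻¹ - 1) * Vw + Kc⁻¹ * (X ^ 2 + Y ^ 2 - Puu - 2 * R - Pww) ≤ T)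
    (hVw : Vw ≤ BK * Y ^ 2) (hPuu : Puu ≤ X ^ 2) (hPww : Pww ≤ εK ^ 2 * Y ^ 2)
    (hR : |R| ≤ εK * X * Y) (htK : tK * X ^ 2 ≤ Vu + Kc⁻¹ * (X ^ 2 - Puu)) :
    (1 - ε) * tK * X ^ 2 - 2 * (Kc⁻¹ * εK) * X * Y + (Kc⁻¹ * (1 - εK ^ 2) - (ε⁻¹ - 1) * BK) * Y ^ 2
      ≤ T := by
  have hKi : 0 ≤ Kc⁻¹ := (inv_pos.2 hKc).le
  have hεi : 0 ≤ ε⁻¹ - 1 := by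
    rw [sub_nonneg]; exact (one_le_inv₀ hε0).2 hε1
  have h1 : -((ε⁻¹ - 1) * (BK * Y ^ 2)) ≤ -((ε⁻¹ - 1) * Vw) :=
    neg_le_neg (mul_le_mul_of_nonneg_left hVw hεi)
  have h2 : -(2 * R) ≥ -(2 * (εK * X * Y)) := by linarith [(le_abs_self R).trans hR]
  have h3 : Kc⁻¹ * (X ^ 2 + Y ^ 2 - Puu - 2 * R - Pww) ≥
      Kc⁻¹ * (X ^ 2 - Puu) - 2 * (Kc⁻¹ * εK) * X * Y + Kc⁻¹ * (1 - εK ^ 2) * Y ^ 2 := by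
    have : X ^ 2 + Y ^ 2 - Puu - 2 * R - Pww ≥ (X ^ 2 - Puu) - 2 * (εK * X * Y) + (1 - εK ^ 2) * Y ^ 2 := by
      linarith
    have := mul_le_mul_of_nonneg_left this hKi
    linarith
  have h4 : (1 - ε) * (Vu + Kc⁻¹ * (X ^ 2 - Puu)) ≤ (1 - ε) * Vu + Kc⁻¹ * (X ^ 2 - Puu) := by
    have hP : 0 ≤ Kc⁻¹ * (X ^ 2 - Puu) := mul_nonneg hKi (by linarith)
    nlinarith
  have h5 : (1 - ε) * (tK * X ^ 2) ≤ (1 - ε) * (Vu + Kc⁻¹ * (X ^ 2 - Puu)) :=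
    mul_le_mul_of_nonneg_left htK (by linarith)
  linarith

/-! ### The Gram-form split `|a + b|² ≥ (1-ε)|a|² − (ε⁻¹−1)|b|²` (appended 2026-08-24, prove-1 gen10) -/

/-- **Peter–Paul for a sum:** `(1 - ε)‖a‖² - (ε⁻¹ - 1)‖b‖² ≤ ‖a + b‖²` for `0 < ε` (used termwise
on the Gram form: `𝒱(u + w) ≥ (1-ε)𝒱(u) - (ε⁻¹-1)𝒱(w)`, IDEAS-prolate §87.4). -/
theorem norm_sq_add_ge_split (a b : ℂ) {ε : ℝ} (hε0 : 0 < ε) :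
    (1 - ε) * ‖a‖ ^ 2 - (ε⁻¹ - 1) * ‖b‖ ^ 2 ≤ ‖a + b‖ ^ 2 := by
  have htri : ‖a‖ - ‖b‖ ≤ ‖a + b‖ := by
    have := norm_sub_norm_le a (-b)
    rw [norm_neg, sub_neg_eq_add] at this
    linarith [abs_sub_abs_le_abs_sub ‖a‖ ‖b‖, norm_add_le a b, norm_le_norm_add_norm_sub' a b,
      norm_sub_le_norm_add a b]
  have htri' : |‖a‖ - ‖b‖| ≤ ‖a + b‖ := by
    rw [abs_le]
    refine ⟨?_, htri⟩
    have := norm_sub_norm_le b (-a)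
    rw [norm_neg, sub_neg_eq_add, add_comm] at this
    linarith
  have hsq : (‖a‖ - ‖b‖) ^ 2 ≤ ‖a + b‖ ^ 2 := by
    rw [← sq_abs (‖a‖ - ‖b‖)]
    exact pow_le_pow_left₀ (abs_nonneg _) htri' 2
  have hpp : 2 * ‖a‖ * ‖b‖ ≤ ε * ‖a‖ ^ 2 + ε⁻¹ * ‖b‖ ^ 2 := by
    have hid : ε⁻¹ * (ε * ‖a‖ - ‖b‖) ^ 2 = ε * ‖a‖ ^ 2 - 2 * ‖a‖ * ‖b‖ + ε⁻¹ * ‖b‖ ^ 2 := by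
      field_simp
      ring
    nlinarith [mul_nonneg (inv_pos.2 hε0).le (sq_nonneg (ε * ‖a‖ - ‖b‖))]
  nlinarith

/-- The same summed with non-negative weights: `Σ c_i ‖a_i + b_i‖² ≥ (1-ε) Σ c_i‖a_i‖² - (ε⁻¹-1) Σ c_i‖b_i‖²`. -/
theorem sum_norm_sq_add_ge_split {ι : Type*} (s : Finset ι) (c : ι → ℝ) (a b : ι → ℂ) {ε : ℝ}
    (hε0 : 0 < ε) (hc : ∀ i ∈ s, 0 ≤ c i) :
    (1 - ε) * ∑ i ∈ s, c i * ‖a i‖ ^ 2 - (ε⁻¹ - 1) * ∑ i ∈ s, c i * ‖b i‖ ^ 2 ≤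
      ∑ i ∈ s, c i * ‖a i + b i‖ ^ 2 := by
  rw [Finset.mul_sum, Finset.mul_sum, ← Finset.sum_sub_distrib]
  refine Finset.sum_le_sum fun i hi ↦ ?_
  have h := mul_le_mul_of_nonneg_left (norm_sq_add_ge_split (a i) (b i) hε0) (hc i hi)
  nlinarith

/-! ### The leakage on a general window `[-a, a]` (appended 2026-08-24, prove-1 gen10)

The certificate works on `L²([-a, a])` with the dilated Legendre functions
`e_k(x) = a^{-1/2} P̃_k(x/a)`, whose line transforms are `a^{1/2} c_k G_k(at)` (substitution
`x = as` in Gegenbauer's integral), so the leakage function is `L_K(t) = 2a (1 - Σ_{k<K}(2k+1) j_k(at)²)`.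
Only ORTHONORMALITY of the finite family is needed (`norm_sq_inner_le_of_orthogonal`), not completeness. -/

section Window

variable {a : ℝ}

/-- A continuous function lies in `L²([-a, a])`. -/
theorem memLp_two_restrict_Icc_of_continuous {f : ℝ → ℂ} (hf : Continuous f) (a : ℝ) :
    MemLp f 2 (volume.restrict (Icc (-a) a)) := by
  rw [memLp_two_iff_integrable_sq_norm hf.aestronglyMeasurable]
  exact (by fun_prop : Continuous fun x ↦ ‖f x‖ ^ 2).integrableOn_Icc

/-- The dilated normalised Legendre function `e_k(x) = a^{-1/2} P̃_k(x/a)` on the window `[-a, a]`. -/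
noncomputable def legendreWindowFn (a : ℝ) (k : ℕ) (x : ℝ) : ℂ :=
  (((Real.sqrt a)⁻¹ : ℝ) : ℂ) * legendreFn k (x / a)

/-- `e_k` is continuous. -/
theorem continuous_legendreWindowFn (a : ℝ) (k : ℕ) : Continuous (legendreWindowFn a k) :=
  continuous_const.mul ((continuous_legendreFn k).comp (continuous_id.div_const a))

/-- The class of `e_k` in `L²([-a, a])`. -/
noncomputable def legendreWindowL2 (a : ℝ) (k : ℕ) : Lp ℂ 2 (volume.restrict (Icc (-a) a)) :=
  (memLp_two_restrict_Icc_of_continuous (continuous_legendreWindowFn a k) a).toLp _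

/-- The class of `x ↦ e^{itx}` in `L²([-a, a])`. -/
noncomputable def expWindowL2 (a t : ℝ) : Lp ℂ 2 (volume.restrict (Icc (-a) a)) :=
  (memLp_two_restrict_Icc_of_continuous (f := fun x : ℝ ↦ cexp (I * t * x)) (by fun_prop) a).toLp _

/-- Inner products of classes of continuous functions in `L²([-a, a])` are integrals. -/
theorem inner_toLp_eq_integral {f g : ℝ → ℂ} (hf : Continuous f) (hg : Continuous g) (a : ℝ) :
    ⟪(memLp_two_restrict_Icc_of_continuous hf a).toLp _,
      (memLp_two_restrict_Icc_of_continuous hg a).toLp _⟫_ℂ =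
      ∫ x in Icc (-a) a, conj (f x) * g x := by
  rw [L2.inner_def]
  refine integral_congr_ae ?_
  filter_upwards [MemLp.coeFn_toLp (memLp_two_restrict_Icc_of_continuous hf a),
    MemLp.coeFn_toLp (memLp_two_restrict_Icc_of_continuous hg a)] with x hx hy
  rw [RCLike.inner_apply, hx, hy, mul_comm]

/-- Set integrals over `[-a, a]` are interval integrals (`a ≥ 0`). -/
theorem integral_Icc_window_eq_intervalIntegral (ha : 0 ≤ a) (f : ℝ → ℂ) :
    ∫ x in Icc (-a) a, f x = ∫ x in (-a)..a, f x := by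
  rw [intervalIntegral.integral_of_le (by linarith : -a ≤ a), ← integral_Icc_eq_integral_Ioc]

/-- The substitution `x = a s`: `∫_{[-a,a]} F(x/a) dx = a ∫_{[-1,1]} F(s) ds` (`a > 0`). -/
theorem integral_Icc_window_comp_div (ha : 0 < a) (F : ℝ → ℂ) :
    ∫ x in Icc (-a) a, F (x / a) = (a : ℂ) * ∫ s, F s ∂legendreMeasure := by
  rw [integral_Icc_window_eq_intervalIntegral ha.le, intervalIntegral.integral_comp_div F ha.ne',
    show -a / a = -1 by rw [neg_div, div_self ha.ne'], div_self ha.ne',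
    intervalIntegral.integral_of_le (by norm_num : (-1 : ℝ) ≤ 1), ← integral_Icc_eq_integral_Ioc]
  rfl

/-- **Orthonormality of the dilated Legendre functions in `L²([-a, a])`** (`a > 0`). -/
theorem orthonormal_legendreWindowL2 (ha : 0 < a) : Orthonormal ℂ (legendreWindowL2 a) := by
  classical
  rw [orthonormal_iff_ite]
  intro n m
  unfold legendreWindowL2
  rw [inner_toLp_eq_integral (continuous_legendreWindowFn a n) (continuous_legendreWindowFn a m)]
  have hc : ((Real.sqrt a)⁻¹ : ℝ) * (Real.sqrt a)⁻¹ = a⁻¹ := by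
    rw [← mul_inv, Real.mul_self_sqrt ha.le]
  have hfun : (fun x ↦ conj (legendreWindowFn a n x) * legendreWindowFn a m x) =
      fun x ↦ ((a⁻¹ : ℝ) : ℂ) * (fun s ↦ conj (legendreFn n s) * legendreFn m s) (x / a) := by
    funext x
    simp only [legendreWindowFn, map_mul, Complex.conj_ofReal]
    rw [← hc]
    push_cast
    ring
  rw [hfun, integral_const_mul,
    integral_Icc_window_comp_div ha (fun s ↦ conj (legendreFn n s) * legendreFn m s),
    integral_conj_legendreFn_mul_legendreFn, ← mul_assoc, show ((a⁻¹ : ℝ) : ℂ) * (a : ℂ) = 1 by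
      rw [Complex.ofReal_inv, inv_mul_cancel₀ (Complex.ofReal_ne_zero.2 ha.ne')], one_mul]

/-- The Rayleigh coefficients on the window: `⟪e_k, e^{it·}⟫ = a^{1/2} c_k G_k(at)`. -/
theorem inner_legendreWindowL2_exp (ha : 0 < a) (k : ℕ) (t : ℝ) :
    ⟪legendreWindowL2 a k, expWindowL2 a t⟫_ℂ =
      (Real.sqrt a : ℂ) * (legendreNormConst k * gegenbauerIntegral k (a * t)) := by
  unfold legendreWindowL2 expWindowL2
  rw [inner_toLp_eq_integral (continuous_legendreWindowFn a k) (by fun_prop)]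
  have hfun : (fun x : ℝ ↦ conj (legendreWindowFn a k x) * cexp (I * t * x)) =
      fun x ↦ (((Real.sqrt a)⁻¹ : ℝ) : ℂ) *
        (fun s : ℝ ↦ (legendreNormConst k : ℂ) * gegenbauerKernel k (a * t) s) (x / a) := by
    funext x
    have ha' : (a : ℂ) ≠ 0 := Complex.ofReal_ne_zero.2 ha.ne'
    simp only [legendreWindowFn, map_mul, Complex.conj_ofReal, legendreFn_apply, gegenbauerKernel]
    push_cast
    rw [show I * ((a : ℂ) * (t : ℂ)) * ((x : ℂ) / (a : ℂ)) = I * (t : ℂ) * (x : ℂ) by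
      field_simp]
    ring
  rw [hfun, integral_const_mul,
    integral_Icc_window_comp_div ha (fun s : ℝ ↦ (legendreNormConst k : ℂ) * gegenbauerKernel k (a * t) s),
    integral_const_mul]
  rw [gegenbauerIntegral, intervalIntegral.integral_of_le (by norm_num : (-1 : ℝ) ≤ 1),
    ← integral_Icc_eq_integral_Ioc]
  have hsa : (((Real.sqrt a)⁻¹ : ℝ) : ℂ) * (a : ℂ) = (Real.sqrt a : ℂ) := by
    have h1 : (Real.sqrt a)⁻¹ * a = Real.sqrt a := by
      rw [inv_mul_eq_iff_eq_mul₀ (Real.sqrt_pos.2 ha).ne', Real.mul_self_sqrt ha.le]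
    exact_mod_cast h1
  rw [← mul_assoc, hsa]

/-- `‖⟪e_k, e^{it·}⟫‖² = 2a (2k+1) j_k(at)²`. -/
theorem norm_sq_inner_legendreWindowL2_exp (ha : 0 < a) (k : ℕ) (t : ℝ) :
    ‖⟪legendreWindowL2 a k, expWindowL2 a t⟫_ℂ‖ ^ 2 = 2 * a * (2 * k + 1) * sphBesselJ k (a * t) ^ 2 := by
  rw [inner_legendreWindowL2_exp ha, norm_mul, norm_mul, Complex.norm_real, Complex.norm_real,
    Real.norm_of_nonneg (Real.sqrt_nonneg a), Real.norm_eq_abs, norm_gegenbauerIntegral_eq, mul_pow,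
    mul_pow, mul_pow, Real.sq_sqrt ha.le, sq_abs, sq_abs, legendreNormConst_sq]
  ring

/-- `‖e^{it·}‖²_{L²([-a,a])} = 2a`. -/
theorem norm_sq_expWindowL2 (ha : 0 < a) (t : ℝ) : ‖expWindowL2 a t‖ ^ 2 = 2 * a := by
  rw [← inner_self_eq_norm_sq (𝕜 := ℂ)]
  unfold expWindowL2
  rw [inner_toLp_eq_integral (by fun_prop) (by fun_prop)]
  have h1 : (fun x : ℝ ↦ conj (cexp (I * t * x)) * cexp (I * t * x)) = fun _ ↦ (1 : ℂ) := by
    funext x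
    rw [Complex.conj_mul', show I * (t : ℂ) * (x : ℂ) = ((t * x : ℝ) : ℂ) * I by push_cast; ring,
      Complex.norm_exp_ofReal_mul_I]
    simp
  rw [h1, setIntegral_const, measureReal_def]
  rw [Real.volume_Icc, ENNReal.toReal_ofReal (by linarith), Complex.real_smul, mul_one, RCLike.re_to_complex,
    Complex.ofReal_re]
  ring

/-- **Pointwise leakage of the Legendre section on the window `[-a, a]`** (`a > 0`): if
`w ∈ L²([-a, a])` is orthogonal to `e_0, …, e_{K-1}` then for every real `t`
`‖⟪e^{it·}, w⟫‖² ≤ 2a (1 - Σ_{k<K} (2k+1) j_k(at)²) · ‖w‖²` — the `L_K(t)` of IDEAS-prolate §87.4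
(`⟪e^{it·}, w⟫ = ∫_{-a}^{a} w(x) e^{-itx} dx = Fw(-t)`; `L_K` is even in `t`). -/
theorem norm_sq_inner_expWindow_le_leakage (ha : 0 < a) (K : ℕ)
    {w : Lp ℂ 2 (volume.restrict (Icc (-a) a))} (hw : ∀ k < K, ⟪legendreWindowL2 a k, w⟫_ℂ = 0)
    (t : ℝ) :
    ‖⟪expWindowL2 a t, w⟫_ℂ‖ ^ 2 ≤
      2 * a * (1 - ∑ k ∈ Finset.range K, (2 * k + 1) * sphBesselJ k (a * t) ^ 2) * ‖w‖ ^ 2 := by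
  have h := norm_sq_inner_le_of_orthogonal (orthonormal_legendreWindowL2 ha) (Finset.range K)
    (fun k hk ↦ hw k (Finset.mem_range.1 hk)) (expWindowL2 a t)
  rw [norm_sq_expWindowL2 ha, Finset.sum_congr rfl fun k _ ↦ norm_sq_inner_legendreWindowL2_exp ha k t]
    at h
  have e : 2 * a * (1 - ∑ k ∈ Finset.range K, (2 * (k : ℝ) + 1) * sphBesselJ k (a * t) ^ 2) =
      2 * a - ∑ k ∈ Finset.range K, 2 * a * (2 * (k : ℝ) + 1) * sphBesselJ k (a * t) ^ 2 := by
    rw [mul_sub, mul_one, Finset.mul_sum]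
    refine congrArg _ (Finset.sum_congr rfl fun k _ ↦ by ring)
  rw [e]
  exact h

end Window

end Summit.RiemannHypothesis.RiemannHypothesis.Theorems
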